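import Summits.HodgeConjecture.HodgeConjecture.Theorems.F0P2oYCoinvariantsOfFrameAssembly   -- ★ p831955: the abstract assembler (whose chart this file EXPORTS)
import HarnessLib

/-!
# Crux `H413`, programme P2, N3 road (a)-block (E1) — THE CHART EXPORT of the abstract assembler: the `Y`-adapted dot model of the Weil
# representation `ω = toRep ∘ s` TOGETHER WITH its frame chart `Γ`, its intertwiner `Ψ`, the transported splitting `s′` and the fibre map `φ₀`

Cell hodgecm-mathlib (D-0151), FLOOR 0, crux item H413 = stmt-HodgeConjecture-24833, programme P2; N3 road (`F0/P2/B-p18/g28/N3-ROAD.v2.B-p18g28.md`),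
(a)-block, row (S5) «THE DICTIONARY» (lead B-p18 (g28) 20:49:54Z, desk F0P2-plan (g8) 20:50:18Z), seat F0P2-p01 (g8), brick (E1).  THEOREMS ONLY (no `def`,
no instance, no notation, no named fact, no `sorry`); never imports a `Cruxes/…/Lines` module; kernel lane `--supports stmt-HodgeConjecture-24833 --as helper`.
HC_CM is proved only modulo the printed citations until rung 0 closes; nothing printed is asserted here.

WHY.  ★ p831955 `coinvariantsKer_comp_eq_comap_of_frame` concludes `∃ Ψ φ₀, (fibre formula) ∧ Coinvariants.ker (ω|_N) = Ψ⁻¹(ker φ₀)` and its proof DISCARDS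
the intertwining law of `Ψ` (`obtain ⟨Ψ, hΨ, -⟩`), the chart `Γ` and the transported splitting `s′`; ★ p832817 (the CM closer) concludes only
`Nonempty (r_N(ω_v) ≃ₗ[ℂ] 𝒮(L⁺_v))`.  No GROUP ACTION can cross either statement.  Clause (a) of the N3 letter ★ `GelbartRogawski1991.thetaType_nonsplit_jacquetModule`
needs the `U(V₁) × U(W)`-action on `S_Y = r_N(ω_v)` (the (S5) dictionary with ★ `lineWeilCM`), and the (D3d) assembler's Schur step needs «frame-diagonal elements act on
`𝒮 ⧸ K` through the dot model».  This file re-runs the assembler with NOTHING DROPPED.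

THE STATEMENT (`exists_chart_of_frame`).  Binders = ★ `coinvariantsKer_comp_eq_comap_of_frame` VERBATIM.  Conclusion: there are
`Γ : 𝕎 = Fⁿ × Fⁿ ≃ₗ[F] F^{Fin 2 ⊔ Fin m} × F^{Fin 2 ⊔ Fin m}` (the frame chart ★ `exists_frameChart`), `Ψ : 𝒮(Fⁿ) ≃ₗ[ℂ] 𝒮(F^{Fin 2 ⊔ Fin m})`,
`s′ : G →* S̃p_ψ(ρ_dot)` and the fibre-over-`0` map `φ₀ : 𝒮(F^{Fin 2 ⊔ Fin m}) →ₗ 𝒮(F^{Fin m})` with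
(i) the chart READS vectors through the hermitian frame: `Γ (reIm v) = ((re⟨x₀,v⟩, im⟨x₀,v⟩ ‖ a⁻¹·re⟨b,v⟩), (im⟨y₀,v⟩, −re⟨y₀,v⟩ ‖ im⟨b,v⟩))`, its inverse formula, and
`Γ` preserves the symplectic (alternating) forms; (ii) `Ψ` INTERTWINES the Schrödinger model `ρ_T` with the dot model along the Heisenberg isomorphism over `Γ`:
`Ψ (ρ_T((w, t)) f) = ρ_dot((Γ w, t + ½(β_dot(Γw, Γw) − β_T(w, w)))) (Ψ f)`; (iii) `Ψ` intertwines the two Weil representations: `Ψ (ω_s(g) f) = ω_{s′}(g) (Ψ f)`;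
(iv) the symplectic component of `s′ g` acts through the chart by the matrix `M g`: `(s′ g)·(Γ (reIm v)) = Γ (reIm (M g · v))`; (v) `(φ₀ f)(u₀) = f(0 ‖ u₀)`;
(vi) `Coinvariants.ker (ω_s|_N) = Ψ⁻¹ (ker φ₀)`.  Proof = the ★ p831955 proof with the discarded data kept.
[MoeglinVignerasWaldspurger1987, Chap. 2 I.7, II.1, Chap. 3 §IV.2, §IV.5; Kudla1986, Thm. 2.8; GelbartRogawski1991, §3.2 (3.2.1)–(3.2.3) p. 457.]

## References
* [MoeglinVignerasWaldspurger1987] C. Mœglin, M.-F. Vignéras, J.-L. Waldspurger, *Correspondances de Howe sur un corps p-adique*, LNM 1291 (1987): Chap. 2 I.7, II.1;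
  Chap. 3 §IV.2 (mixed model), §IV.5 (filtration de Kudla).
* [Kudla1986] S. Kudla, *On the local theta-correspondence*, Invent. Math. 83 (1986): Thm. 2.8 and its proof.
* [GelbartRogawski1991] S. Gelbart, J. Rogawski, Invent. Math. 105 (1991): §3.2 (3.2.1)–(3.2.3) p. 457.
-/

set_option autoImplicit false
set_option linter.dupNamespace false -- the mandated namespace repeats the single-problem summit's segment

noncomputable section

open scoped MatrixGroups
open _root_.Matrix
open Literature.NumberTheory.Automorphic Literature.NumberTheory.Automorphic.UnitaryGroup
open Literature.NumberTheory.Automorphic.UnitaryGroup.QuadraticCoordinates Literature.NumberTheory.Automorphic.UnitaryGroup.IsQuadraticCoordinates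
open Literature.RepresentationTheory Literature.RepresentationTheory.HeisenbergGroup
open Summit.HodgeConjecture.HodgeConjecture.Cruxes.H413.F0P2oYCoinvariantsOfFrameAssembly
open Summit.HodgeConjecture.HodgeConjecture.Cruxes.H413.F0P2oFrameStabiliserYTriviality

namespace Summit.HodgeConjecture.HodgeConjecture.Cruxes.H413.F0P2oYCoinvariantsChart

section Chart

variable {F : Type*} [Field F] [ValuativeRel F] [TopologicalSpace F] [IsNonarchimedeanLocalField F] [Invertible (2 : F)]
  {ψ : AddChar F Circle} (hl : IsLocallyConstant (⇑ψ : F → Circle))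
  {S : Type*} [CommRing S] {φ : F →+* S} {Ψq : (F × F) ≃+ S} {δ : S} {d : F} (hq : IsQuadraticCoordinates φ Ψq δ d)
  {σ : S →+* S} {n : Type*} [Fintype n] [DecidableEq n] {T : Matrix n n F}
  (hb₁ : ∀ y : n → F, Continuous fun u : n → F => Matrix.toLinearMap₂' F T u y)
  {m : ℕ} {x₀ y₀ : n → S} {b : Fin m → n → S} {a : Fin m → F}
  {G : Type*} [Group G] (s : G →* MpPsi (schrodingerSB (Matrix.toLinearMap₂' F T) ψ hl hb₁)) (M : G →* GL n S) (N : Subgroup G)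

set_option maxHeartbeats 800000 in -- the 12-conjunct statement alone exceeds the default at `whnf`
include hq in
/-- **THE CHART EXPORT** — the `Y`-adapted dot model of `ω = toRep ∘ s` with its frame chart `Γ`, intertwiner `Ψ`, transported splitting `s′` and fibre map `φ₀`:
(i) `Γ (reIm v)` = the frame coordinates of `v`, the inverse formula, and `Γ` is symplectic; (ii) `Ψ (ρ_T(w,t) f) = ρ_dot(Γ w, t + ½(β_dot(Γw,Γw) − β_T(w,w))) (Ψ f)`;
(iii) `Ψ (ω_s(g) f) = ω_{s′}(g) (Ψ f)`; (iv) `(s′ g)·Γ(reIm v) = Γ(reIm (M g · v))`; (v) `(φ₀ f)(u₀) = f(0 ‖ u₀)`; (vi) `Coinvariants.ker (ω_s|_N) = Ψ⁻¹(ker φ₀)`.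
Binders as in ★ `coinvariantsKer_comp_eq_comap_of_frame` (module docstring of ★ p831955 for their reading).
[cite: Kudla1986, Thm. 2.8] [cite: MoeglinVignerasWaldspurger1987, Chap. 2 I.7, II.1; Chap. 3 §IV.2, §IV.5] [cite: GelbartRogawski1991, §3.2 (3.2.3) p. 457] -/
theorem exists_chart_of_frame (hψ : ψ.IsContinuousNontrivial) (hd : ∀ r : F, r * r ≠ d)
    (hσφ : ∀ x, σ (φ x) = φ x) (hσδ : σ δ = -δ) (hσσ : ∀ z, σ (σ z) = z) (hT : T.IsSymm) (hTd : IsUnit T.det)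
    (hx : hermForm σ (T.map φ) x₀ x₀ = 0) (hy : hermForm σ (T.map φ) y₀ y₀ = 0) (hxy : hermForm σ (T.map φ) x₀ y₀ = 1)
    (hxb : ∀ j, hermForm σ (T.map φ) x₀ (b j) = 0) (hyb : ∀ j, hermForm σ (T.map φ) y₀ (b j) = 0)
    (hbb : ∀ j j', j ≠ j' → hermForm σ (T.map φ) (b j) (b j') = 0) (hba : ∀ j, hermForm σ (T.map φ) (b j) (b j) = φ (a j))
    (ha : ∀ j, a j ≠ 0)
    (hexp : ∀ v : n → S, v = hermForm σ (T.map φ) y₀ v • x₀ + hermForm σ (T.map φ) x₀ v • y₀ +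
      ∑ j, (φ (a j)⁻¹ * hermForm σ (T.map φ) (b j) v) • b j)
    (hM : ∀ g, M g ∈ unitaryGroupOfForm σ (T.map φ))
    (hι : ∀ (g : G) (x : n → S), ((s g).1.1).1 (reIm Ψq n x) = reIm Ψq n ((M g : Matrix n n S) *ᵥ x))
    (hN : ∀ nn ∈ N, ((M nn⁻¹ : GL n S) : Matrix n n S) *ᵥ x₀ = x₀ ∧
      ∀ j, ∃ μ : S, ((M nn⁻¹ : GL n S) : Matrix n n S) *ᵥ b j = b j + μ • x₀)
    (hgen : ∀ nn ∈ N, ∃ t : G, (∃ α : S, ((M t⁻¹ : GL n S) : Matrix n n S) *ᵥ x₀ = α • x₀) ∧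
      (∀ j, ∃ ν : S, ((M t⁻¹ : GL n S) : Matrix n n S) *ᵥ b j = ν • b j) ∧
      ∃ n₁ ∈ N, ∃ n₂ ∈ N, nn = t * nn * t⁻¹ * nn⁻¹ * (n₁ * n₂ * n₁⁻¹ * n₂⁻¹))
    (hZ : ∀ t : F, ∃ nn ∈ N, ((M nn⁻¹ : GL n S) : Matrix n n S) *ᵥ x₀ = x₀ ∧ (∀ j, ((M nn⁻¹ : GL n S) : Matrix n n S) *ᵥ b j = b j) ∧
      ∃ μ : S, ((M nn⁻¹ : GL n S) : Matrix n n S) *ᵥ y₀ = y₀ + μ • x₀ ∧ σ μ = φ t * δ) :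
    ∃ (Γ : ((n → F) × (n → F)) ≃ₗ[F] (((Fin 2 ⊕ Fin m) → F) × ((Fin 2 ⊕ Fin m) → F)))
      (Ψ : SchwartzBruhat (n → F) ≃ₗ[ℂ] SchwartzBruhat ((Fin 2 ⊕ Fin m) → F))
      (s' : G →* MpPsi (schrodingerSB (dotProductBilin F F (m := Fin 2 ⊕ Fin m)) ψ hl (fun y => continuous_dotProductBilin_left y)))
      (φ₀ : SchwartzBruhat ((Fin 2 ⊕ Fin m) → F) →ₗ[ℂ] SchwartzBruhat (Fin m → F)),
      -- (i) the chart: forward formula, inverse formula, symplectic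
      (∀ v : n → S, Γ (reIm Ψq n v) =
        (Sum.elim ![re Ψq (hermForm σ (T.map φ) x₀ v), im Ψq (hermForm σ (T.map φ) x₀ v)]
            (fun j => (a j)⁻¹ * re Ψq (hermForm σ (T.map φ) (b j) v)),
          Sum.elim ![im Ψq (hermForm σ (T.map φ) y₀ v), -re Ψq (hermForm σ (T.map φ) y₀ v)]
            (fun j => im Ψq (hermForm σ (T.map φ) (b j) v)))) ∧
      (∀ (x y : (Fin 2 ⊕ Fin m) → F), Γ.symm (x, y) = reIm Ψq n
        (Ψq (x (Sum.inl 0), x (Sum.inl 1)) • y₀ + (φ (y (Sum.inl 0)) * δ - φ (y (Sum.inl 1))) • x₀ +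
          ∑ j, Ψq (x (Sum.inr j), (a j)⁻¹ * y (Sum.inr j)) • b j)) ∧
      (∀ w w' : (n → F) × (n → F),
        alt (polar (dotProductBilin F F (m := Fin 2 ⊕ Fin m))) (Γ w) (Γ w') = alt (polar (Matrix.toLinearMap₂' F T)) w w') ∧
      -- (ii) `Ψ` intertwines the Heisenberg models along the Heisenberg isomorphism over `Γ`
      (∀ (w : (n → F) × (n → F)) (t : F) (f : SchwartzBruhat (n → F)),
        Ψ (schrodingerSB (Matrix.toLinearMap₂' F T) ψ hl hb₁ ⟨w, t⟩ f) =
          schrodingerSB (dotProductBilin F F (m := Fin 2 ⊕ Fin m)) ψ hl (fun y => continuous_dotProductBilin_left y)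
            ⟨Γ w, t + ⅟(2 : F) * (polar (dotProductBilin F F (m := Fin 2 ⊕ Fin m)) (Γ w) (Γ w) - polar (Matrix.toLinearMap₂' F T) w w)⟩ (Ψ f)) ∧
      -- (iii) `Ψ` intertwines the Weil representations of `s` and `s′`
      (∀ (g : G) (f : SchwartzBruhat (n → F)),
        Ψ (MpPsi.toRep (schrodingerSB (Matrix.toLinearMap₂' F T) ψ hl hb₁) (s g) f) =
          MpPsi.toRep (schrodingerSB (dotProductBilin F F (m := Fin 2 ⊕ Fin m)) ψ hl (fun y => continuous_dotProductBilin_left y)) (s' g) (Ψ f)) ∧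
      -- (iv) the symplectic component of `s′ g` acts through the chart by `M g`
      (∀ (g : G) (v : n → S), ((s' g).1.1).1 (Γ (reIm Ψq n v)) = Γ (reIm Ψq n ((M g : Matrix n n S) *ᵥ v))) ∧
      -- (v) the fibre over `0`
      (∀ (f : SchwartzBruhat ((Fin 2 ⊕ Fin m) → F)) (u₀ : Fin m → F),
        (φ₀ f : (Fin m → F) → ℂ) u₀ = (f : ((Fin 2 ⊕ Fin m) → F) → ℂ) (Sum.elim 0 u₀)) ∧
      -- (vi) the `N`-coboundaries are the preimage of `ker φ₀`
      Representation.Coinvariants.ker (((MpPsi.toRep (schrodingerSB (Matrix.toLinearMap₂' F T) ψ hl hb₁)).comp s).comp N.subtype) =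
        (LinearMap.ker φ₀).comap (Ψ : SchwartzBruhat (n → F) →ₗ[ℂ] SchwartzBruhat ((Fin 2 ⊕ Fin m) → F)) := by
  classical
  -- adapted from ★ p831955 `coinvariantsKer_comp_eq_comap_of_frame` (A-p12 (g17)); nothing is dropped here.
  -- the dot model on `F^{Fin 2 ⊔ Fin m}` and the fibre model on `F^{Fin m}`
  have hb₂ : ∀ y : (Fin 2 ⊕ Fin m) → F, Continuous fun u : (Fin 2 ⊕ Fin m) → F => dotProductBilin F F u y :=
    fun y => continuous_dotProductBilin_left y
  have hb₀ : ∀ y₀ : Fin m → F, Continuous fun u₀ : Fin m → F => dotProductBilin F F u₀ y₀ := fun y => continuous_dotProductBilin_left y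
  -- the frame chart
  obtain ⟨Γ, hΓ₁, hΓ₂, hΓ₃⟩ := exists_frameChart hq hT hσφ hσδ hσσ hx hy hxy hxb hyb hbb hba ha hexp
  obtain ⟨Γv, hΓv⟩ : ∃ Γv : (n → S) → ((Fin 2 ⊕ Fin m) → F) × ((Fin 2 ⊕ Fin m) → F), Γv = fun v => Γ (reIm Ψq n v) := ⟨_, rfl⟩
  have hΓ : ∀ v : n → S, Γv v =
      (Sum.elim ![re Ψq (hermForm σ (T.map φ) x₀ v), im Ψq (hermForm σ (T.map φ) x₀ v)]
          (fun j => (a j)⁻¹ * re Ψq (hermForm σ (T.map φ) (b j) v)),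
        Sum.elim ![im Ψq (hermForm σ (T.map φ) y₀ v), -re Ψq (hermForm σ (T.map φ) y₀ v)]
          (fun j => im Ψq (hermForm σ (T.map φ) (b j) v))) := fun v => by rw [hΓv]; exact hΓ₁ v
  have hsurj : ∀ w : ((Fin 2 ⊕ Fin m) → F) × ((Fin 2 ⊕ Fin m) → F), ∃ v : n → S, Γv v = w := fun w =>
    ⟨(reIm Ψq n).symm (Γ.symm w), by rw [hΓv]; dsimp only; rw [AddEquiv.apply_symm_apply, LinearEquiv.apply_symm_apply]⟩
  -- the Heisenberg isomorphism, the intertwiner, the transported splitting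
  have halt := sub_eq_sub_of_alt_eq Γ hΓ₃
  obtain ⟨Ψ, hΨ, -⟩ := exists_intertwiner_implements_conj T hTd hl hb₁ hb₂ Γ hΓ₃ hψ
    (Heisenberg.conjCoboundaryEquiv Γ halt) (fun _ _ => rfl)
  have hφ := Heisenberg.conjCoboundaryEquiv_ofSymplectic_act Γ halt
  obtain ⟨s', hs'⟩ : ∃ s' : G →* MpPsi (schrodingerSB (dotProductBilin F F (m := Fin 2 ⊕ Fin m)) ψ hl hb₂), s' =
      (MpPsi.congr (schrodingerSB (Matrix.toLinearMap₂' F T) ψ hl hb₁) (schrodingerSB (dotProductBilin F F (m := Fin 2 ⊕ Fin m)) ψ hl hb₂)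
        (Φ := Heisenberg.conjCoboundaryEquiv Γ halt) (T := Ψ) (φ := symplecticConjOfAlt Γ halt) hΨ hφ).toMonoidHom.comp s := ⟨_, rfl⟩
  -- the symplectic component of `s′ g` is `Γ (s g) Γ⁻¹`, so it acts through `Γv` by the matrix `M g`
  have hs'1 : ∀ g : G, (s' g).1.1 = symplecticConjOfAlt Γ halt (s g).1.1 := fun g => by rw [hs']; rfl
  have hact : ∀ (g : G) (v : n → S), ((s' g).1.1).1 (Γv v) = Γv ((M g : Matrix n n S) *ᵥ v) := by
    intro g v
    rw [hs'1, hΓv]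
    dsimp only
    rw [symplecticConjOfAlt_apply, LinearEquiv.symm_apply_apply, hι]
  have hadj : ∀ (g : G) (x v : n → S),
      hermForm σ (T.map φ) x ((M g : Matrix n n S) *ᵥ v) = hermForm σ (T.map φ) (((M g⁻¹ : GL n S) : Matrix n n S) *ᵥ x) v := by
    intro g x v
    rw [map_inv]
    exact hermForm_mulVec_eq_of_mem σ (T.map φ) (hM g) x v
  -- the fibre over `0`; the dot-model identity; transport back along `Ψ`
  obtain ⟨φ₀, hφ₀⟩ := exists_fibreMap (F := F) (ι₁ := Fin 2) (ι₀ := Fin m) (0 : Fin 2 → F)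
  have key := coinvariantsKer_eq_ker_of_frameAction hl hb₂ hb₀ φ₀ hφ₀ hq Γv hΓ hsurj s' M hact hadj N hψ hd ha hN hgen hZ
  -- (iii) `Ψ` intertwines the Weil representations
  have hω : ∀ (g : G) (f : SchwartzBruhat (n → F)),
      Ψ (MpPsi.toRep (schrodingerSB (Matrix.toLinearMap₂' F T) ψ hl hb₁) (s g) f) =
        MpPsi.toRep (schrodingerSB (dotProductBilin F F (m := Fin 2 ⊕ Fin m)) ψ hl hb₂) (s' g) (Ψ f) := by
    intro g f
    have h := (MpPsi.toRep_congr_comp_apply _ _ hΨ hφ s g f).symm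
    rw [← hs'] at h
    exact h
  refine ⟨Γ, Ψ, s', φ₀, hΓ₁, hΓ₂, hΓ₃, fun w t f => hΨ ⟨w, t⟩ f, hω, fun g v => ?_, hφ₀, ?_⟩
  · -- (iv)
    have h := hact g v
    rw [hΓv] at h
    exact h
  · -- (vi)
    rw [← key]
    exact coinvariantsKer_eq_comap_of_intertwiner _ _ Ψ fun nn f => hω (nn : G) f

end Chart

end Summit.HodgeConjecture.HodgeConjecture.Cruxes.H413.F0P2oYCoinvariantsChart

end
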